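import Mathlib
import HarnessLib
import Literature.Analysis.FluidPDE.SelfSimilar
import Literature.Analysis.FluidPDE.NSBoundedMildSmoothing
import Literature.Analysis.FluidPDE.KNSSLocalSmoothingHolds
import Literature.Analysis.UnboundedOperators.HeatKernel
import Literature.Analysis.FluidPDE.TaoEnstrophyLocalisation
import Summits.NavierStokesRegularity.NavierStokesRegularity.Theorems.LocalSineTubeDoorProfileAlignedWindowRigidityAncient

/-!
# Route `PoloidalWindowDoor` (staged, nsreg-p1), crux `PoloidalWindowRigidity` (K2) — the SCALE-SHARP GRADIENT RATE
# `‖∇v(t)‖ ≤ C₁/(−t)` on the route's Type-I class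

Cell ns-regularity-ideate, seat p7 (LEAD on K2; support file for the open stub, residue (G); CENSUS-K2G §12 M8).
For a profile of the route's Type-I class (rate `‖v(t,x)‖ ≤ C/√(−t)`, continuity on the open slab, unit-viscosity
Oseen–Duhamel identity between negative times) the velocity gradient obeys the SCALE-SHARP rate

  `‖Dv(t)(y)‖ ≤ C₁/(−t)`  for all `t < 0`, `y ∈ ℝ³`,  with ONE constant `C₁ = C₁(C)`

(`exists_fderiv_rate_of_class`).  The tree already has the slice-wise bound `…Ancient.exists_fderiv_slice_bound`
(`∃ M'(s)`, KNSS Prop. 4.1 through the global smoothing fact, whose constant is existential); the RATE needs the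
UNIFORM constants `(ε, C_L)` of the local smoothing fact `knss2009_local_smoothing_holds` (KNSS 2009 Prop. 4.1 with
(4.3)–(4.5)): restart at the datum time `s' = (1+δ)t` with `δ = ε/(4C'²)`, `C' = max C 1`, bound `M = C'√2/√(−t)` on
the window `(s', t/2)`; the local smooth solution lives on `(s', s' + ε/M²) ∋ t`, coincides with `v` there
(`exists_local_smooth_representative`, bounded uniqueness), and its first-derivative bound
`√(t − s')·‖Dv(t)‖ ≤ C_L M` is `‖Dv(t)‖ ≤ C_L C' √(2/δ)/(−t)`.  This is the decaying slope `ε(t) = C₁/(−t)`,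
`ε(t)√(−t) → 0`, consumed by the decaying-slope barrier (CENSUS-K2G §12, Lemma 12.1); in particular the vorticity of
every profile of the class satisfies `sup_x ‖curl v(t,x)‖ = O(1/(−t))` (`exists_curl_rate_of_class`, via the tree's
`‖curl v‖ ≤ ‖curlCLM‖ ‖Dv‖`).

WHAT THIS IS NOT: not a claim about Navier–Stokes regularity — a regularity rate for the route's profile class, for a
STAGED door route (bears_on LADDER-NS N0, rung N0-LocalTubeDoorPoloidal).
-/

noncomputable section

-- the summit and its single sub-problem share the name (CONVENTIONS §1), as in every Theorems file
set_option linter.dupNamespace false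

namespace Summit.NavierStokesRegularity.NavierStokesRegularity.Theorems.PoloidalWindowDoorPoloidalWindowRigidityClassRate

open MeasureTheory Set Function Filter Topology Metric
open scoped ENNReal
open Literature.Analysis Literature.Analysis.FluidPDE
open Summit.NavierStokesRegularity.NavierStokesRegularity.Theorems.LocalSineTubeDoorProfileAlignedWindowRigidityAncient

variable {C : ℝ} {v : ℝ → EuclideanSpace ℝ (Fin 3) → EuclideanSpace ℝ (Fin 3)}

/-- **THE SCALE-SHARP GRADIENT RATE ON THE CLASS.**  For a profile of the route's Type-I class there is ONE constant
`C₁` with `‖Dv(t)(y)‖ ≤ C₁/(−t)` for every `t < 0` and every `y` (KNSS 2009 Prop. 4.1 with its uniform constants,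
restarted at the datum time `(1+δ)t`). -/
theorem exists_fderiv_rate_of_class (hrate : HasTypeITimeDecay C v)
    (hcont : ContinuousOn (uncurry v) (Iio (0 : ℝ) ×ˢ univ))
    (hmild : ∀ s t : ℝ, s < t → t < 0 → ∀ y,
      v t y = UnboundedOperators.heatExtension (v s) (t - s) y - oseenDuhamel 1 s v v t y) :
    ∃ C₁ : ℝ, ∀ t < 0, ∀ y, ‖fderiv ℝ (v t) y‖ ≤ C₁ / (-t) := by
  -- the UNIFORM constants of the local smoothing fact, first space derivative, no time derivative
  obtain ⟨ε, hε, CL, hCL, hL⟩ := knss2009_local_smoothing_holds (EuclideanSpace ℝ (Fin 3)) 1 0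
  set C' : ℝ := max C 1 with hC'
  have hC'1 : 1 ≤ C' := le_max_right _ _
  have hC'0 : 0 < C' := lt_of_lt_of_le one_pos hC'1
  have hCC' : C ≤ C' := le_max_left _ _
  set δ : ℝ := ε / (4 * C' ^ 2) with hδ
  have hδ0 : 0 < δ := div_pos hε (by positivity)
  refine ⟨CL * C' * Real.sqrt 2 / Real.sqrt δ, fun t ht y => ?_⟩
  have hnt : 0 < -t := neg_pos.2 ht
  -- datum time `s' = (1+δ) t`, window `(s', t/2)`, bound `M = C' √2 / √(−t)`
  set s' : ℝ := t - δ * (-t) with hs'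
  have hs't : s' < t := by rw [hs']; nlinarith
  have hs'0 : s' < 0 := hs't.trans ht
  have hT : s' < t / 2 := by linarith
  set M : ℝ := C' * Real.sqrt 2 / Real.sqrt (-t) with hM
  have hsq0 : 0 < Real.sqrt (-t) := Real.sqrt_pos.2 hnt
  have hM0 : 0 < M := div_pos (mul_pos hC'0 (Real.sqrt_pos.2 two_pos)) hsq0
  -- the Type-I rate gives `‖v τ‖ ≤ M` for `τ < t/2`
  have hbound : ∀ τ < t / 2, ∀ x, ‖v τ x‖ ≤ M := by
    intro τ hτ x
    have hτ0 : τ < 0 := by linarith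
    have hnτ : -t / 2 < -τ := by linarith
    refine (hrate τ hτ0 x).trans ?_
    have h1 : C / Real.sqrt (-τ) ≤ C' / Real.sqrt (-τ) :=
      div_le_div_of_nonneg_right hCC' (Real.sqrt_nonneg _)
    refine h1.trans ?_
    rw [hM, div_le_div_iff₀ (Real.sqrt_pos.2 (by linarith)) hsq0]
    have h2 : Real.sqrt (-t) ≤ Real.sqrt 2 * Real.sqrt (-τ) := by
      rw [← Real.sqrt_mul (by norm_num : (0:ℝ) ≤ 2)]
      exact Real.sqrt_le_sqrt (by linarith)
    calc C' * Real.sqrt (-t) ≤ C' * (Real.sqrt 2 * Real.sqrt (-τ)) :=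
          mul_le_mul_of_nonneg_left h2 hC'0.le
      _ = C' * Real.sqrt 2 * Real.sqrt (-τ) := by ring
  -- hypotheses of the local representative lemma on the window `(s', t/2)` with datum `v s'`
  have ha : AEStronglyMeasurable (v s') volume := (continuous_slice hcont hs'0).aestronglyMeasurable
  have haM : eLpNorm (v s') ∞ volume ≤ ENNReal.ofReal M := by
    rw [eLpNorm_exponent_top]
    exact eLpNormEssSup_le_of_ae_bound (Eventually.of_forall fun x => hbound _ (by linarith) x)
  have hsub : Ioo s' (t / 2) ×ˢ (univ : Set (EuclideanSpace ℝ (Fin 3))) ⊆ Iio 0 ×ˢ univ :=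
    prod_mono (fun τ hτ => lt_trans hτ.2 (by linarith)) subset_rfl
  have hu : AEStronglyMeasurable (uncurry v) (volume.restrict (Ioo s' (t / 2) ×ˢ univ)) :=
    (hcont.mono hsub).aestronglyMeasurable (measurableSet_Ioo.prod MeasurableSet.univ)
  have hub : ∀ τ ∈ Ioo s' (t / 2), eLpNorm (v τ) ∞ volume ≤ ENNReal.ofReal M := by
    intro τ hτ
    rw [eLpNorm_exponent_top]
    exact eLpNormEssSup_le_of_ae_bound (Eventually.of_forall fun x => hbound τ hτ.2 x)
  have hmild' : ∀ τ ∈ Ioo s' (t / 2), v τ =ᵐ[volume] fun x =>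
      UnboundedOperators.heatExtension (v s') (1 * (τ - s')) x - oseenDuhamel 1 s' v v τ x := fun τ hτ =>
    Eventually.of_forall fun x => by
      rw [one_mul]; exact hmild s' τ hτ.1 (by linarith [hτ.2]) x
  obtain ⟨w, -, -, hrep, -, hbd⟩ :=
    exists_local_smooth_representative hL one_pos hM0 hCL ha haM hu hub hmild'
  -- `t` lies in the local window `(s', s' + ε/M²)`: `t − s' = δ(−t) < ε(−t)/(2C'²) = ε/M²`
  have hM2 : M ^ 2 = 2 * C' ^ 2 / (-t) := by
    rw [hM, div_pow, mul_pow, Real.sq_sqrt (by norm_num : (0:ℝ) ≤ 2), Real.sq_sqrt hnt.le]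
    ring
  have hq : ε * 1 / M ^ 2 = ε * (-t) / (2 * C' ^ 2) := by
    rw [hM2]
    field_simp
  have hδlt : δ * (-t) < ε * (-t) / (2 * C' ^ 2) := by
    rw [hδ, lt_div_iff₀ (by positivity)]
    have h1 : ε / (4 * C' ^ 2) * -t * (2 * C' ^ 2) = ε * -t / 2 := by
      field_simp
      ring
    rw [h1]
    linarith [mul_pos hε hnt]
  have hwin : t < s' + ε * 1 / M ^ 2 := by
    rw [hq, hs']
    linarith
  have htmem : t ∈ Ioo s' (min (s' + ε * 1 / M ^ 2) (t / 2)) := ⟨hs't, lt_min hwin (by linarith)⟩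
  have htmem' : t ∈ Ioo s' (s' + ε * 1 / M ^ 2) := ⟨hs't, hwin⟩
  -- the representative IS `v t`
  have hvw : v t = w t := by
    funext x
    rw [← hrep t htmem x, one_mul]
    exact hmild s' t hs't ht x
  -- the first-derivative bound of the local solution at time `t`
  have h := hbd t htmem' y
  rw [pow_zero, mul_one] at h
  simp only [Nat.cast_one, one_mul] at h
  have hid : (fun y' => iteratedDeriv 0 (fun τ => w τ y') t) = w t := by
    funext y'; rw [iteratedDeriv_zero]
  have hts : t - s' = δ * (-t) := by rw [hs']; ring
  have hsqrt : (t - s') ^ ((1:ℝ) / 2) = Real.sqrt δ * Real.sqrt (-t) := by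
    rw [hts, ← Real.sqrt_eq_rpow, Real.sqrt_mul hδ0.le]
  rw [hid, norm_iteratedFDeriv_one, ← hvw, hsqrt] at h
  -- `√δ √(−t) ‖Dv‖ ≤ CL M = CL C' √2/√(−t)`  ⟹  `‖Dv‖ ≤ CL C' √2 /(√δ (−t))`
  have hpos : 0 < Real.sqrt δ * Real.sqrt (-t) := mul_pos (Real.sqrt_pos.2 hδ0) hsq0
  rw [mul_comm] at h
  have h2 : ‖fderiv ℝ (v t) y‖ ≤ CL * M / (Real.sqrt δ * Real.sqrt (-t)) := by
    rw [le_div_iff₀ hpos]; exact h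
  refine h2.trans (le_of_eq ?_)
  have hst : Real.sqrt (-t) ^ 2 = -t := Real.sq_sqrt hnt.le
  have htne : (t : ℝ) ≠ 0 := ht.ne
  rw [hM]
  field_simp
  rw [hst]
  field_simp

/-- **Vorticity rate on the class**: `‖curl v(t)(y)‖ ≤ C₂/(−t)` with `C₂ = ‖curlCLM‖·C₁` (tree `norm_curl_le`). -/
theorem exists_curl_rate_of_class (hrate : HasTypeITimeDecay C v)
    (hcont : ContinuousOn (uncurry v) (Iio (0 : ℝ) ×ˢ univ))
    (hmild : ∀ s t : ℝ, s < t → t < 0 → ∀ y,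
      v t y = UnboundedOperators.heatExtension (v s) (t - s) y - oseenDuhamel 1 s v v t y) :
    ∃ C₂ : ℝ, ∀ t < 0, ∀ y, ‖curl (v t) y‖ ≤ C₂ / (-t) := by
  obtain ⟨C₁, hC₁⟩ := exists_fderiv_rate_of_class hrate hcont hmild
  set K : ℝ := ‖(curlCLM : (EuclideanSpace ℝ (Fin 3) →L[ℝ] EuclideanSpace ℝ (Fin 3)) →L[ℝ]
    EuclideanSpace ℝ (Fin 3))‖ with hK
  have hK0 : 0 ≤ K := by rw [hK]; positivity
  refine ⟨K * C₁, fun t ht y => ?_⟩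
  have h : ‖curl (v t) y‖ ≤ K * ‖fderiv ℝ (v t) y‖ := norm_curl_le (v t) y
  calc ‖curl (v t) y‖ ≤ K * ‖fderiv ℝ (v t) y‖ := h
    _ ≤ K * (C₁ / -t) := mul_le_mul_of_nonneg_left (hC₁ t ht y) hK0
    _ = K * C₁ / -t := by ring

end Summit.NavierStokesRegularity.NavierStokesRegularity.Theorems.PoloidalWindowDoorPoloidalWindowRigidityClassRate

end
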